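import Summits.AtomisticToContinuum.HydrodynamicLimit.Theses.OneFlightGossipEngine
import Summits.AtomisticToContinuum.HydrodynamicLimit.Theorems.TransferActivityTails.Negative.EquilibriumReduction
import Summits.AtomisticToContinuum.HydrodynamicLimit.Theorems.OneFlightGossipEngineCollisionActivityTailsMeanEnergyBound
import Literature.MathematicalPhysics.KineticTheory.HardSphereBBGKYLiouvilleFlow

/-!
# IdeatorOneSketch — crux idea `coboundary-hot-cold-split` for `EnergyActivityTails` (stmt-AtomisticToContinuum-17703)

First lemmas of the line, typed over existing declarations (crux-ideate round 1, ideator 1).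
Nothing here asserts the crux.  PROVED: the inner-product core of `K1` (normal components are swapped by the
elastic law; energy jump = partner's incoming normal energy − own incoming normal energy; GAIN ≤ impulse × PARTNER's
normal speed; GAIN ≤ partner's energy) and the dominations `EAT ⇒ HST(M)`, `EAT ⇒ HSTin` (the transfer target is
weaker than the crux).  TYPED (the line's first stubs, not claims): `RecordKinematics` (K1 in record form),
`Coboundary` (K2, telescoping along the orbit), `PathwiseSplit` (K3), `Reduction` / `ReductionIn` (K4: `CAT ∧ HST ⇒ EAT`).
-/

noncomputable section

open MeasureTheory Filter Set Topology
open scoped ENNReal InnerProductSpace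

namespace Summit.AtomisticToContinuum.HydrodynamicLimit.Cruxes.EnergyActivityTails.CoboundaryHotColdSplit

open Literature.MathematicalPhysics.KineticTheory Literature.Analysis.FluidPDE
open Summit.AtomisticToContinuum.HydrodynamicLimit.Theorems.TransferActivityTailsNegative

/-! ## §0 Read-back: the crux is `TailsOf energyOf` -/

theorem energyActivityTails_iff :
    Summit.AtomisticToContinuum.HydrodynamicLimit.Theses.OneFlightGossipEngine.EnergyActivityTails ↔
      TailsOf energyOf :=
  Iff.rfl

theorem collisionActivityTails_iff :
    Summit.AtomisticToContinuum.HydrodynamicLimit.Theses.OneFlightGossipEngine.CollisionActivityTails ↔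
      TailsOf momentumOf :=
  Iff.rfl

/-! ## §1 The new summands -/

variable {N : ℕ}

/-- Signed kinetic-energy change of `fst` in the record `c` (the GAIN of `i`; `energyOf = |gainOf|`). -/
def gainOf (N : ℕ) (i : Fin (N + 1)) (c : Rec N) : ℝ :=
  if c.fst = i then (‖c.postVel.1‖ ^ 2 - ‖c.preVel.1‖ ^ 2) / 2 else 0

/-- Incoming normal speed of the PARTNER (`snd`) along the impact vector `ω` of the record
(`ω` is a unit vector at contact, `norm_ofConfig_impactVec`; junk-safe division by `‖ω‖`). -/
def partnerNormalSpeed (c : Rec N) : ℝ := |⟪c.preVel.2, c.impactVec⟫_ℝ| / ‖c.impactVec‖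

/-- **Hot supply at level `M`**: the energy RECEIVED by `i` (positive part of its gain) in a collision
whose partner arrives with normal speed `> M`; zero on every collision with a cold-normal giver. -/
def hotSupplyOf (M : ℝ) (N : ℕ) (i : Fin (N + 1)) (c : Rec N) : ℝ :=
  if c.fst = i ∧ M < partnerNormalSpeed c then max (gainOf N i c) 0 else 0

/-- `HST(M)`: the crux's frame verbatim with the hot-supply summand (the proposed transfer target C⁺,
one `M` at a time; the reduction `K4` uses ONE fixed `M`, the domination below gives `EAT ⇒ HST M` for all `M`). -/
def HotSupplyTails (M : ℝ) : Prop := TailsOf (hotSupplyOf M)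

theorem hotSupplyOf_nonneg (M : ℝ) (N : ℕ) (i : Fin (N + 1)) (c : Rec N) : 0 ≤ hotSupplyOf M N i c := by
  unfold hotSupplyOf; split_ifs
  · exact le_max_right _ _
  · exact le_rfl

theorem hotSupplyOf_le_energyOf (M : ℝ) (N : ℕ) (i : Fin (N + 1)) (c : Rec N) :
    hotSupplyOf M N i c ≤ energyOf N i c := by
  unfold hotSupplyOf energyOf gainOf
  by_cases hi : c.fst = i
  · simp only [hi, true_and, if_true]
    split_ifs
    · refine max_le ?_ (by positivity)
      exact div_le_div_of_nonneg_right (le_abs_self _) (by norm_num)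
    · positivity
  · simp [hi]

/-- **`EAT ⇒ HST(M)` for every `M`**: the transfer target is WEAKER than the crux (domination). -/
theorem hotSupplyTails_of_energyActivityTails (M : ℝ)
    (h : Summit.AtomisticToContinuum.HydrodynamicLimit.Theses.OneFlightGossipEngine.EnergyActivityTails) :
    HotSupplyTails M :=
  tailsOf_of_le (hotSupplyOf_nonneg M) (hotSupplyOf_le_energyOf M) (energyActivityTails_iff.1 h)

/-! ## §2 K1 — record kinematics (pure inner-product algebra of `reflectVel`) -/

section Kinematics

variable {E : Type*} [NormedAddCommGroup E] [InnerProductSpace ℝ E]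

/-- Post-collisional normal component of `fst` = pre-collisional normal component of `snd`
(normal components are SWAPPED by the elastic law). -/
theorem inner_reflectVel_fst (n : E) (hn : n ≠ 0) (p : E × E) :
    ⟪(reflectVel n p).1, n⟫_ℝ = ⟪p.2, n⟫_ℝ := by
  have hn' : ‖n‖ ^ 2 ≠ 0 := pow_ne_zero 2 (norm_ne_zero_iff.2 hn)
  simp only [reflectVel, inner_sub_left, inner_smul_left, real_inner_self_eq_norm_sq, RCLike.conj_to_real]
  field_simp
  ring

/-- The jump of `fst`'s velocity is along `n`, of size the difference of the two normal components:
`p.1 - (reflectVel n p).1 = ((⟪p.1,n⟫ - ⟪p.2,n⟫)/‖n‖²) • n`. -/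
theorem fst_sub_reflectVel_fst (n : E) (p : E × E) :
    p.1 - (reflectVel n p).1 = ((⟪p.1, n⟫_ℝ - ⟪p.2, n⟫_ℝ) / ‖n‖ ^ 2) • n := by
  simp only [reflectVel, inner_sub_left, sub_sub_cancel, sub_div]

/-- **K1(a) — the energy jump of `fst` is (own outgoing normal energy) − (own incoming normal energy)
= (partner's incoming normal energy) − (own incoming normal energy):**
`‖v⁺‖² − ‖v⁻‖² = (⟪v⁺,n⟫² − ⟪v⁻,n⟫²)/‖n‖²` for `v⁻ = (reflectVel n (v⁺, w⁺)).1`. -/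
theorem norm_sq_fst_sub_norm_sq_reflectVel_fst (n : E) (hn : n ≠ 0) (p : E × E) :
    ‖p.1‖ ^ 2 - ‖(reflectVel n p).1‖ ^ 2 =
      (⟪p.1, n⟫_ℝ ^ 2 - ⟪(reflectVel n p).1, n⟫_ℝ ^ 2) / ‖n‖ ^ 2 := by
  have hn' : ‖n‖ ^ 2 ≠ 0 := pow_ne_zero 2 (norm_ne_zero_iff.2 hn)
  set a := (⟪p.1, n⟫_ℝ - ⟪p.2, n⟫_ℝ) / ‖n‖ ^ 2 with ha
  have hpre : (reflectVel n p).1 = p.1 - a • n := by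
    rw [ha, ← fst_sub_reflectVel_fst n p]; abel
  rw [inner_reflectVel_fst n hn p, hpre, @norm_sub_sq_real, norm_smul, inner_smul_right, Real.norm_eq_abs,
    mul_pow, sq_abs]
  rw [ha]
  field_simp
  ring

/-- Pre-collisional normal component of `snd` = post-collisional normal component of `fst` (the swap, other side). -/
theorem inner_reflectVel_snd (n : E) (hn : n ≠ 0) (p : E × E) :
    ⟪(reflectVel n p).2, n⟫_ℝ = ⟪p.1, n⟫_ℝ := by
  have hn' : ‖n‖ ^ 2 ≠ 0 := pow_ne_zero 2 (norm_ne_zero_iff.2 hn)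
  simp only [reflectVel, inner_add_left, inner_smul_left, real_inner_self_eq_norm_sq, RCLike.conj_to_real]
  field_simp
  rw [inner_sub_left]
  ring

/-- The size of `fst`'s velocity jump is `|ν_snd − ν_fst|` (difference of the incoming normal components) over `‖n‖`. -/
theorem norm_fst_sub_reflectVel_fst (n : E) (hn : n ≠ 0) (p : E × E) :
    ‖p.1 - (reflectVel n p).1‖ = |⟪(reflectVel n p).2, n⟫_ℝ - ⟪(reflectVel n p).1, n⟫_ℝ| / ‖n‖ := by
  have hn0 : 0 < ‖n‖ := norm_pos_iff.2 hn
  rw [fst_sub_reflectVel_fst, norm_smul, Real.norm_eq_abs, abs_div, abs_of_pos (pow_pos hn0 2),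
    inner_reflectVel_snd n hn, inner_reflectVel_fst n hn]
  field_simp

/-- Scalar core of K1(b): `max ((A² − B²)/2) 0 ≤ |A − B|·|A|`  (`A² − B² = 2A(A−B) − (A−B)²`). -/
theorem max_half_sq_sub_sq_le (A B : ℝ) : max ((A ^ 2 - B ^ 2) / 2) 0 ≤ |A - B| * |A| := by
  refine max_le ?_ (by positivity)
  have h1 : (A ^ 2 - B ^ 2) / 2 ≤ (A - B) * A := by nlinarith [sq_nonneg (A - B)]
  exact h1.trans (by rw [← abs_mul]; exact le_abs_self _)

/-- **K1(b), abstract form — GAIN ≤ IMPULSE × PARTNER'S NORMAL SPEED**: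
`(‖v⁺‖² − ‖v⁻‖²)⁺/2 ≤ ‖v⁺ − v⁻‖ · (|⟪w⁻, n⟫|/‖n‖)` for `(v⁻, w⁻) = reflectVel n (v⁺, w⁺)`, `n ≠ 0`. -/
theorem gain_pos_le_impulse_mul_partnerNormal (n : E) (hn : n ≠ 0) (p : E × E) :
    max ((‖p.1‖ ^ 2 - ‖(reflectVel n p).1‖ ^ 2) / 2) 0 ≤
      ‖p.1 - (reflectVel n p).1‖ * (|⟪(reflectVel n p).2, n⟫_ℝ| / ‖n‖) := by
  have hn0 : 0 < ‖n‖ := norm_pos_iff.2 hn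
  have hn2 : 0 < ‖n‖ ^ 2 := pow_pos hn0 2
  set A := ⟪(reflectVel n p).2, n⟫_ℝ with hA
  set B := ⟪(reflectVel n p).1, n⟫_ℝ with hB
  have hjump : ‖p.1‖ ^ 2 - ‖(reflectVel n p).1‖ ^ 2 = (A ^ 2 - B ^ 2) / ‖n‖ ^ 2 := by
    rw [norm_sq_fst_sub_norm_sq_reflectVel_fst n hn p, ← inner_reflectVel_snd n hn p]
  rw [hjump, norm_fst_sub_reflectVel_fst n hn p, ← hA, ← hB]
  have key' : (A ^ 2 - B ^ 2) / 2 ≤ |A - B| * |A| := (le_max_left _ _).trans (max_half_sq_sub_sq_le A B)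
  refine max_le ?_ (by positivity)
  have hre : (A ^ 2 - B ^ 2) / ‖n‖ ^ 2 / 2 = ((A ^ 2 - B ^ 2) / 2) / ‖n‖ ^ 2 := by ring
  rw [hre, div_le_iff₀ hn2]
  have hne : ‖n‖ ≠ 0 := hn0.ne'
  calc (A ^ 2 - B ^ 2) / 2 ≤ |A - B| * |A| := key'
    _ = |A - B| / ‖n‖ * (|A| / ‖n‖) * ‖n‖ ^ 2 := by field_simp

/-- **K1(c), abstract form — GAIN ≤ PARTNER'S NORMAL ENERGY ≤ PARTNER'S ENERGY**:
`(‖v⁺‖² − ‖v⁻‖²)⁺/2 ≤ ‖w⁻‖²/2` for `(v⁻, w⁻) = reflectVel n (v⁺, w⁺)`, `n ≠ 0` (Cauchy–Schwarz on `⟪w⁻,n⟫²/(2‖n‖²)`). -/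
theorem gain_pos_le_partnerEnergy (n : E) (hn : n ≠ 0) (p : E × E) :
    max ((‖p.1‖ ^ 2 - ‖(reflectVel n p).1‖ ^ 2) / 2) 0 ≤ ‖(reflectVel n p).2‖ ^ 2 / 2 := by
  have hn0 : 0 < ‖n‖ := norm_pos_iff.2 hn
  have hn2 : 0 < ‖n‖ ^ 2 := pow_pos hn0 2
  rw [norm_sq_fst_sub_norm_sq_reflectVel_fst n hn p, ← inner_reflectVel_snd n hn p]
  set w := (reflectVel n p).2 with hw
  set A := ⟪w, n⟫_ℝ with hA
  set B := ⟪(reflectVel n p).1, n⟫_ℝ with hB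
  refine max_le ?_ (by positivity)
  have h1 : |A| ≤ ‖w‖ * ‖n‖ := abs_real_inner_le_norm _ _
  have h2 : A ^ 2 ≤ (‖w‖ * ‖n‖) ^ 2 := by
    rw [← sq_abs]; exact pow_le_pow_left₀ (abs_nonneg _) h1 2
  have h3 : A ^ 2 / ‖n‖ ^ 2 ≤ ‖w‖ ^ 2 := by
    rw [div_le_iff₀ hn2]; simpa [mul_pow] using h2
  have h4 : (A ^ 2 - B ^ 2) / ‖n‖ ^ 2 ≤ A ^ 2 / ‖n‖ ^ 2 :=
    div_le_div_of_nonneg_right (by nlinarith [sq_nonneg B]) hn2.le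
  linarith

end Kinematics

/-- **K1 (record form, as consumed by the line; provable from the three lemmas above + `norm_ofConfig_impactVec`).**
For a record read off a contact configuration: (a) `gain = (ν_snd² − ν_fst²)/2`; (b) `gain⁺ ≤ ‖Δv_fst‖·|ν_snd|`;
(c) `gain⁺ ≤ ν_snd²/2 ≤ ‖v_snd⁻‖²/2`, where `ν` are incoming normal components along the unit impact vector. -/
def RecordKinematics : Prop :=
  ∀ (σ : ℝ), 0 < σ → ∀ (N : ℕ) (z : Config (N + 1) (Fin 3) T3) (t : ℝ) (i j : Fin (N + 1)), i ≠ j →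
    z ∈ contactSet (Torus.geometry (Fin 3)) (N + 1) (hsDiameter σ N) i j →
    let c : Rec N := HardSphereCollisionRecord.ofConfig (Torus.geometry (Fin 3)) (hsDiameter σ N) z t i j
    (‖c.postVel.1‖ ^ 2 - ‖c.preVel.1‖ ^ 2) / 2 =
        (⟪c.preVel.2, c.impactVec⟫_ℝ ^ 2 - ⟪c.preVel.1, c.impactVec⟫_ℝ ^ 2) / 2 ∧
    max ((‖c.postVel.1‖ ^ 2 - ‖c.preVel.1‖ ^ 2) / 2) 0 ≤ ‖c.postVel.1 - c.preVel.1‖ * |⟪c.preVel.2, c.impactVec⟫_ℝ| ∧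
    max ((‖c.postVel.1‖ ^ 2 - ‖c.preVel.1‖ ^ 2) / 2) 0 ≤ ‖c.preVel.2‖ ^ 2 / 2

/-! ## §3 K2 — the coboundary along the orbit, K3 — the pathwise split -/

/-- **K2 (COBOUNDARY / telescoping).** Along a good orbit the window sum of `i`'s signed energy jumps is the
change of `i`'s kinetic energy across the window (velocities are piecewise constant, jump only at `i`'s own
collisions — `IsHardSphereTrajectory.free` / `.binary` + `ofConfig_preVel_eq_leftLim`). -/
def Coboundary : Prop :=
  ∀ (σ : ℝ) (N : ℕ) (Φ : Flow σ N) (z : Config (N + 1) (Fin 3) T3), z ∈ Φ.good →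
    ∀ (a b : ℝ), a ≤ b → ∀ i : Fin (N + 1),
      Φ.collisionSum (Set.Ioc a b) (gainOf N i) z =
        (‖(Φ.flow b z i).2‖ ^ 2 - ‖(Φ.flow a z i).2‖ ^ 2) / 2

/-- **K3 (PATHWISE SPLIT at a fixed hot level `M`).** For every good orbit, window and particle:
`Σ|ΔE_i| ≤ ‖v_i(a)‖²/2 + 2M·Σ‖Δv_i‖ + 2·Σ hotSupply_M`  (K2: `Σ|g| = 2Σg⁺ − (E_i(b) − E_i(a))`;
K1(b) on the cold-giver collisions `|ν_snd| ≤ M`). -/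
def PathwiseSplit : Prop :=
  ∀ (M : ℝ), 0 < M → ∀ (σ : ℝ), 0 < σ → ∀ (N : ℕ) (Φ : Flow σ N) (z : Config (N + 1) (Fin 3) T3), z ∈ Φ.good →
    ∀ (a b : ℝ), a ≤ b → ∀ i : Fin (N + 1),
      Φ.collisionSum (Set.Ioc a b) (energyOf N i) z ≤
        ‖(Φ.flow a z i).2‖ ^ 2 / 2 + 2 * M * Φ.collisionSum (Set.Ioc a b) (momentumOf N i) z +
          2 * Φ.collisionSum (Set.Ioc a b) (hotSupplyOf M N i) z

/-- `HSTin` — the transfer target with the hot level chosen INSIDE the frame, at the same stage as `V₀` (after the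
profiles, `σ`, the solution, the flows and `t`), so that "hot" means hot relative to THIS solution
(`M ≫ sup√θ + sup|u|` on `[0,t]`).  The crux's frame verbatim with `∃ M > 0` inserted before `∃ V₀`. -/
def HotSupplyTailsIn : Prop :=
  ∀ (a₀ θ₀ : T3 → ℝ) (u₀ : T3 → V3), Continuous a₀ → Continuous θ₀ → Continuous u₀ →
    (∀ x, 0 < a₀ x) → (∀ x, 0 < θ₀ x) → ∃ σ₀ : ℝ, 0 < σ₀ ∧ ∀ σ : ℝ, 0 < σ → σ < σ₀ →
    ∀ (T : ℝ) (ρ θ : ℝ → T3 → ℝ) (u : ℝ → T3 → V3), IsHardSphereEulerSolution σ T ρ u θ →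
    ∀ Φ : (N : ℕ) → Flow σ N,
    TendstoHydroFieldsAt (fun N => localGibbsLaw σ a₀ u₀ θ₀ N (Φ N)) Φ ρ u θ 0 →
    ∀ t ∈ Set.Ico 0 T, ∃ M : ℝ, 0 < M ∧ ∃ V₀ : ℝ, 0 < V₀ ∧ ∀ V : ℝ, V₀ ≤ V → ∀ ε : ℝ, 0 < ε →
    ∃ τ₀ : ℝ, 0 < τ₀ ∧ ∀ τ : ℝ, τ₀ ≤ τ → ∃ N₀ : ℕ, ∀ N : ℕ, N₀ ≤ N → ∀ s ∈ Set.Icc 0 t,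
      ∫⁻ z, ENNReal.ofReal (((N : ℝ) + 1)⁻¹ * ∑ i : Fin (N + 1),
          Set.indicator {y : ℝ | V < y} (fun y => y)
            (σ / τ * (Φ N).collisionSum (Set.Ioc s (s + τ * ((N : ℝ) + 1) ^ (-(1 / 3 : ℝ))))
              (hotSupplyOf M N i) z))
        ∂(localGibbsLaw σ a₀ u₀ θ₀ N (Φ N)) ≤ ENNReal.ofReal ε

/-- `HST(M)` for one global `M` gives `HSTin` (take that `M` at every `t`). -/
theorem hotSupplyTailsIn_of_hotSupplyTails {M : ℝ} (hM : 0 < M) (h : HotSupplyTails M) : HotSupplyTailsIn := by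
  intro a₀ θ₀ u₀ ha hθ hu ha0 hθ0
  obtain ⟨σ₀, hσ₀, H⟩ := h a₀ θ₀ u₀ ha hθ hu ha0 hθ0
  refine ⟨σ₀, hσ₀, fun σ hσ hσlt T ρ θ u hE Φ hlim t ht => ⟨M, hM, ?_⟩⟩
  exact H σ hσ hσlt T ρ θ u hE Φ hlim t ht

/-- **`EAT ⇒ HSTin`**: the frame-internal target is weaker than the crux as well. -/
theorem hotSupplyTailsIn_of_energyActivityTails
    (h : Summit.AtomisticToContinuum.HydrodynamicLimit.Theses.OneFlightGossipEngine.EnergyActivityTails) :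
    HotSupplyTailsIn :=
  hotSupplyTailsIn_of_hotSupplyTails one_pos (hotSupplyTails_of_energyActivityTails 1 h)

/-! ## §4 K4 — the reduction (what the line proves from K3 + energy conservation + the mean energy bound) -/

/-- **K4 (REDUCTION).** `CAT ∧ HST(M) ⇒ EAT` for any one fixed level `M > 0`: with K3,
`a^e_i ≤ (σ/τ)E_i(s) + 2M a^m_i + 2h_i`, so `a^e_i𝟙{a^e_i > V} ≤ 3(σ/τ)E_i(s) + 6M·a^m_i𝟙{a^m_i > V/(6M)} + 6h_i𝟙{h_i > V/6}`;
the first term has mean `≤ 3(σ/τ)·e₀ → 0` (`HardSphereFlow.configEnergy_flow` + the PROVED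
`CollisionActivityTailsMeanEnergyBound.stub_meanEnergyBound`), the second is CAT at level `V/(6M) ≥ V₀ᵐ`
(`V ≥ 6M V₀ᵐ`) and accuracy `ε/(18M)`, the third is HST at level `V/6 ≥ V₀ʰ` and accuracy `ε/18`. `M` is fixed BEFORE `V₀`,
so no quantifier inversion (`V₀ᵉ := max (6M V₀ᵐ) (6V₀ʰ)`, `τ₀ᵉ := max τ₀ᵐ τ₀ʰ (9σe₀/ε)`). -/
def Reduction : Prop :=
  ∀ M : ℝ, 0 < M →
    Summit.AtomisticToContinuum.HydrodynamicLimit.Theses.OneFlightGossipEngine.CollisionActivityTails →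
    HotSupplyTails M →
    Summit.AtomisticToContinuum.HydrodynamicLimit.Theses.OneFlightGossipEngine.EnergyActivityTails

/-- **K4in (REDUCTION, frame-internal level).** `CAT ∧ HSTin ⇒ EAT`: same proof as K4, with `M = M(profiles, σ, solution, Φ, t)`
read off `HSTin` before `V₀ᵉ := max (6M V₀ᵐ) (6V₀ʰ)` is formed.  With the domination above: GIVEN CAT, `EAT ⟺ HSTin`. -/
def ReductionIn : Prop :=
  Summit.AtomisticToContinuum.HydrodynamicLimit.Theses.OneFlightGossipEngine.CollisionActivityTails →
    HotSupplyTailsIn →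
    Summit.AtomisticToContinuum.HydrodynamicLimit.Theses.OneFlightGossipEngine.EnergyActivityTails

/-- Sanity: the proved mean-energy bound the reduction consumes is the tree's (types match). -/
example : Summit.AtomisticToContinuum.HydrodynamicLimit.Theorems.CollisionActivityTailsMeanEnergyBound.MeanEnergyBound :=
  Summit.AtomisticToContinuum.HydrodynamicLimit.Theorems.CollisionActivityTailsMeanEnergyBound.stub_meanEnergyBound

/-- Sanity: energy conservation along the flow is the tree's. -/
example {σ : ℝ} {N : ℕ} (Φ : Flow σ N) {z : Config (N + 1) (Fin 3) T3} (hz : z ∈ Φ.good) (t : ℝ) :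
    configEnergy (Φ.flow t z) = configEnergy z :=
  Φ.configEnergy_flow hz t

end Summit.AtomisticToContinuum.HydrodynamicLimit.Cruxes.EnergyActivityTails.CoboundaryHotColdSplit
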